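import Literature.Probability.LatticeModels.KCSpinorLaplacian
import HarnessLib

/-!
# Uniform comparability of `H` on vertices and faces (Chelkak–Smirnov 2012, Prop. 3.6 / Remark 3.10) on `ℤ²`

Topic `Literature/Probability/LatticeModels`. D. Chelkak, S. Smirnov, *Universality in the 2D Ising
model and conformal invariance of fermionic observables*, Invent. Math. 189 (2012), Proposition 3.6
and Remark 3.10: for the primitive `H = Im ∫ F²` of an s-holomorphic function, nonnegative on the
superharmonic sublattice near a vertex `w`, the values at the neighbouring vertices of the other
sublattice are bounded by a universal multiple of `H(w)`. This is the local input of the proof of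
Chelkak–Hongler–Izyurov's Lemma 3.10 (boundedness of the spinor observables away from the marked
points, Ann. of Math. 181 (2015), §3.4: "H° - m and H• - m are uniformly comparable at adjacent
points", [CS12, Remark 3.10]).

On `ℤ²` the statement is a finite-dimensional inequality about the eight fluxes around a site
(resp. a plaquette); here it is proved with the explicit constant `32`, by an elementary perturbative
version of the argument of [CS12] (the four increments `Ψ_k - Φ_k ≤ m` force the two "opposite" bond
values to agree up to `O(√m)`, after which the sign pattern `(u - w, u + w, -u + w, -u - w)` of the
unperturbed increments gives `|u| + |w| = O(m)`):

* `site_comparability_alg`, `face_comparability_alg` (the algebra in the frame coordinates of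
  `SHolomorphicPrimitive.lean`, Appendix C of Smirnov 2010);
* **`site_comparability`**: for `F` s-holomorphic at the eight corners around `u`, if
  `Φ(u + e_k, k+1) - Φ(u, k) ≤ m` for all `k` (i.e. `Hw(u + e_k) ≥ Hw(u) - m` for a primitive pair)
  then `Φ(u, k) ≤ 32 m` (i.e. `Hb ≤ Hw(u) + 32 m` at the four plaquettes of `u`);
* **`face_comparability`**: the same around a plaquette;
* `…_of_compat`: the same for sections with sign data of even parity (local gauges of
  `KCSpinorLaplacian.lean`; fluxes are gauge invariant).

Everything is proved; no named fact.

## References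

* D. Chelkak, S. Smirnov, Invent. Math. 189 (2012) 515–580 = arXiv:0910.2045, Prop. 3.6, Remark 3.10
  [ChelkakSmirnov2012Ising].
* D. Chelkak, C. Hongler, K. Izyurov, Ann. of Math. 181 (2015), proof of Lemma 3.10
  [ChelkakHonglerIzyurovAnnals2015].
* S. Smirnov, Ann. of Math. 172 (2010), Lemma 3.8 and Appendix C [Smirnov2010].
-/

noncomputable section

namespace Literature.Probability.LatticeModels

open Complex Finset

/-! ### The algebra -/

/-- **The algebraic core at a site** (coordinates of the frame of `sum_vertexStep_eq_neg_norm_sq`,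
scaled by `√2`): the four increments `D_k ≤ m` force `x₀² + y₂² ≤ 17 m` and
`(y₀ - y₂)² + (y₁ - y₂)² ≤ 4 m`. [cite: ChelkakSmirnov2012Ising, Prop. 3.6] -/
theorem site_comparability_alg (x₀ y₀ y₁ y₂ m : ℝ)
    (h0 : (x₀ - y₀) ^ 2 / 2 - x₀ ^ 2 ≤ m) (h1 : y₁ ^ 2 - (x₀ - y₁) ^ 2 / 2 ≤ m)
    (h2 : (x₀ - y₁ + 2 * y₂) ^ 2 / 2 - y₂ ^ 2 ≤ m) (h3 : (x₀ + y₀ - y₂) ^ 2 - (x₀ + y₀) ^ 2 / 2 ≤ m) :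
    x₀ ^ 2 + y₂ ^ 2 ≤ 17 * m ∧ (y₀ - y₂) ^ 2 + (y₁ - y₂) ^ 2 ≤ 4 * m := by
  obtain ⟨e₀, rfl⟩ : ∃ e, y₀ = y₂ + e := ⟨y₀ - y₂, by ring⟩
  obtain ⟨e₁, rfl⟩ : ∃ e, y₁ = y₂ + e := ⟨y₁ - y₂, by ring⟩
  have iE : ((x₀ - (y₂ + e₀)) ^ 2 / 2 - x₀ ^ 2) + ((y₂ + e₁) ^ 2 - (x₀ - (y₂ + e₁)) ^ 2 / 2) +
      ((x₀ - (y₂ + e₁) + 2 * y₂) ^ 2 / 2 - y₂ ^ 2) + ((x₀ + (y₂ + e₀) - y₂) ^ 2 - (x₀ + (y₂ + e₀)) ^ 2 / 2) =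
      e₀ ^ 2 + e₁ ^ 2 := by ring
  have hE : e₀ ^ 2 + e₁ ^ 2 ≤ 4 * m := by linarith
  have hm : 0 ≤ m := by linarith [sq_nonneg e₀, sq_nonneg e₁]
  -- `w = x₀ y₂`
  have iw1 : ((y₂ + e₁) ^ 2 - (x₀ - (y₂ + e₁)) ^ 2 / 2) + ((x₀ - (y₂ + e₁) + 2 * y₂) ^ 2 / 2 - y₂ ^ 2) =
      2 * (x₀ * y₂) + e₁ ^ 2 := by ring
  have iw2 : ((x₀ - (y₂ + e₀)) ^ 2 / 2 - x₀ ^ 2) + ((x₀ + (y₂ + e₀) - y₂) ^ 2 - (x₀ + (y₂ + e₀)) ^ 2 / 2) =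
      -(2 * (x₀ * y₂)) + e₀ ^ 2 := by ring
  have hw1 : 2 * (x₀ * y₂) ≤ 2 * m := by linarith [sq_nonneg e₁]
  have hw2 : -(2 * (x₀ * y₂)) ≤ 2 * m := by linarith [sq_nonneg e₀]
  have hw : (2 * (x₀ * y₂)) ^ 2 ≤ (2 * m) ^ 2 := by
    have h := mul_nonneg (show 0 ≤ 2 * m - 2 * (x₀ * y₂) by linarith) (show 0 ≤ 2 * m + 2 * (x₀ * y₂) by linarith)
    nlinarith [h]
  -- `u = (y₂² - x₀²)/2`, `L = e₀ (x₀ - y₂) - e₁ (x₀ + y₂)`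
  set L := e₀ * (x₀ - y₂) - e₁ * (x₀ + y₂) with hL
  have iu1 : (y₂ ^ 2 - x₀ ^ 2) - L = ((x₀ - (y₂ + e₀)) ^ 2 / 2 - x₀ ^ 2) + ((y₂ + e₁) ^ 2 - (x₀ - (y₂ + e₁)) ^ 2 / 2) -
      (e₀ ^ 2 + e₁ ^ 2) / 2 := by rw [hL]; ring
  have iu2 : -((y₂ ^ 2 - x₀ ^ 2) - L) = ((x₀ - (y₂ + e₁) + 2 * y₂) ^ 2 / 2 - y₂ ^ 2) +
      ((x₀ + (y₂ + e₀) - y₂) ^ 2 - (x₀ + (y₂ + e₀)) ^ 2 / 2) - (e₀ ^ 2 + e₁ ^ 2) / 2 := by rw [hL]; ring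
  have hu1 : (y₂ ^ 2 - x₀ ^ 2) - L ≤ 2 * m := by linarith [sq_nonneg e₀, sq_nonneg e₁]
  have hu2 : -((y₂ ^ 2 - x₀ ^ 2) - L) ≤ 2 * m := by linarith [sq_nonneg e₀, sq_nonneg e₁]
  have hu : ((y₂ ^ 2 - x₀ ^ 2) - L) ^ 2 ≤ (2 * m) ^ 2 := by
    have h := mul_nonneg (show 0 ≤ 2 * m - ((y₂ ^ 2 - x₀ ^ 2) - L) by linarith) (show 0 ≤ 2 * m + ((y₂ ^ 2 - x₀ ^ 2) - L) by linarith)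
    nlinarith [h]
  have hCS : L ^ 2 ≤ (e₀ ^ 2 + e₁ ^ 2) * ((x₀ - y₂) ^ 2 + (x₀ + y₂) ^ 2) := by
    have : (e₀ ^ 2 + e₁ ^ 2) * ((x₀ - y₂) ^ 2 + (x₀ + y₂) ^ 2) - L ^ 2 = (e₀ * (x₀ + y₂) + e₁ * (x₀ - y₂)) ^ 2 := by
      rw [hL]; ring
    linarith [sq_nonneg (e₀ * (x₀ + y₂) + e₁ * (x₀ - y₂))]
  have hr2 : (x₀ - y₂) ^ 2 + (x₀ + y₂) ^ 2 = 2 * (x₀ ^ 2 + y₂ ^ 2) := by ring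
  have hL2 : L ^ 2 ≤ 8 * m * (x₀ ^ 2 + y₂ ^ 2) := by
    rw [hr2] at hCS
    have h' : (e₀ ^ 2 + e₁ ^ 2) * (2 * (x₀ ^ 2 + y₂ ^ 2)) ≤ 4 * m * (2 * (x₀ ^ 2 + y₂ ^ 2)) :=
      mul_le_mul_of_nonneg_right hE (by positivity)
    linarith
  have hu4 : (y₂ ^ 2 - x₀ ^ 2) ^ 2 ≤ 8 * m ^ 2 + 2 * L ^ 2 := by
    have : 2 * ((y₂ ^ 2 - x₀ ^ 2) - L) ^ 2 + 2 * L ^ 2 - (y₂ ^ 2 - x₀ ^ 2) ^ 2 = ((y₂ ^ 2 - x₀ ^ 2) - 2 * L) ^ 2 := by ring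
    linarith [sq_nonneg ((y₂ ^ 2 - x₀ ^ 2) - 2 * L)]
  have hr4 : (x₀ ^ 2 + y₂ ^ 2) ^ 2 = (y₂ ^ 2 - x₀ ^ 2) ^ 2 + (2 * (x₀ * y₂)) ^ 2 := by ring
  have key : (x₀ ^ 2 + y₂ ^ 2) ^ 2 ≤ 12 * m ^ 2 + 16 * m * (x₀ ^ 2 + y₂ ^ 2) := by linarith
  refine ⟨?_, by ring_nf; ring_nf at hE; linarith⟩
  by_contra hlt
  push Not at hlt
  have h1' : 17 * m * (x₀ ^ 2 + y₂ ^ 2) < (x₀ ^ 2 + y₂ ^ 2) * (x₀ ^ 2 + y₂ ^ 2) :=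
    mul_lt_mul_of_pos_right hlt (lt_of_le_of_lt (by positivity) hlt)
  have h2' : 17 * m * (17 * m) ≤ 17 * m * (x₀ ^ 2 + y₂ ^ 2) := mul_le_mul_of_nonneg_left hlt.le (by positivity)
  nlinarith [h1', h2', key, sq_nonneg m]

/-- **The algebraic core at a plaquette** (coordinates of the frame of `sum_faceStep_eq_norm_sq`,
scaled by `√2`). [cite: ChelkakSmirnov2012Ising, Prop. 3.6] -/
theorem face_comparability_alg (x₀ y₀ y₁ y₃ m : ℝ)
    (h0 : (x₀ + y₀) ^ 2 / 2 - x₀ ^ 2 ≤ m) (h1 : (x₀ - y₀ + y₁) ^ 2 - (x₀ - y₀) ^ 2 / 2 ≤ m)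
    (h2 : (x₀ + y₃ - 2 * y₁) ^ 2 / 2 - y₁ ^ 2 ≤ m) (h3 : y₃ ^ 2 - (x₀ + y₃) ^ 2 / 2 ≤ m) :
    x₀ ^ 2 + y₁ ^ 2 ≤ 17 * m ∧ (y₀ - y₁) ^ 2 + (y₃ - y₁) ^ 2 ≤ 4 * m := by
  obtain ⟨e₀, rfl⟩ : ∃ e, y₀ = y₁ + e := ⟨y₀ - y₁, by ring⟩
  obtain ⟨e₃, rfl⟩ : ∃ e, y₃ = y₁ + e := ⟨y₃ - y₁, by ring⟩
  have iE : ((x₀ + (y₁ + e₀)) ^ 2 / 2 - x₀ ^ 2) + ((x₀ - (y₁ + e₀) + y₁) ^ 2 - (x₀ - (y₁ + e₀)) ^ 2 / 2) +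
      ((x₀ + (y₁ + e₃) - 2 * y₁) ^ 2 / 2 - y₁ ^ 2) + ((y₁ + e₃) ^ 2 - (x₀ + (y₁ + e₃)) ^ 2 / 2) = e₀ ^ 2 + e₃ ^ 2 := by ring
  have hE : e₀ ^ 2 + e₃ ^ 2 ≤ 4 * m := by linarith
  have hm : 0 ≤ m := by linarith [sq_nonneg e₀, sq_nonneg e₃]
  have iw1 : ((x₀ + (y₁ + e₀)) ^ 2 / 2 - x₀ ^ 2) + ((x₀ - (y₁ + e₀) + y₁) ^ 2 - (x₀ - (y₁ + e₀)) ^ 2 / 2) =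
      2 * (x₀ * y₁) + e₀ ^ 2 := by ring
  have iw2 : ((x₀ + (y₁ + e₃) - 2 * y₁) ^ 2 / 2 - y₁ ^ 2) + ((y₁ + e₃) ^ 2 - (x₀ + (y₁ + e₃)) ^ 2 / 2) =
      -(2 * (x₀ * y₁)) + e₃ ^ 2 := by ring
  have hw1 : 2 * (x₀ * y₁) ≤ 2 * m := by linarith [sq_nonneg e₀]
  have hw2 : -(2 * (x₀ * y₁)) ≤ 2 * m := by linarith [sq_nonneg e₃]
  have hw : (2 * (x₀ * y₁)) ^ 2 ≤ (2 * m) ^ 2 := by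
    have h := mul_nonneg (show 0 ≤ 2 * m - 2 * (x₀ * y₁) by linarith) (show 0 ≤ 2 * m + 2 * (x₀ * y₁) by linarith)
    nlinarith [h]
  set L := e₀ * (x₀ + y₁) - e₃ * (x₀ - y₁) with hL
  have iu1 : (y₁ ^ 2 - x₀ ^ 2) + L = ((x₀ + (y₁ + e₀)) ^ 2 / 2 - x₀ ^ 2) + ((y₁ + e₃) ^ 2 - (x₀ + (y₁ + e₃)) ^ 2 / 2) -
      (e₀ ^ 2 + e₃ ^ 2) / 2 := by rw [hL]; ring
  have iu2 : -((y₁ ^ 2 - x₀ ^ 2) + L) = ((x₀ - (y₁ + e₀) + y₁) ^ 2 - (x₀ - (y₁ + e₀)) ^ 2 / 2) +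
      ((x₀ + (y₁ + e₃) - 2 * y₁) ^ 2 / 2 - y₁ ^ 2) - (e₀ ^ 2 + e₃ ^ 2) / 2 := by rw [hL]; ring
  have hu1 : (y₁ ^ 2 - x₀ ^ 2) + L ≤ 2 * m := by linarith [sq_nonneg e₀, sq_nonneg e₃]
  have hu2 : -((y₁ ^ 2 - x₀ ^ 2) + L) ≤ 2 * m := by linarith [sq_nonneg e₀, sq_nonneg e₃]
  have hu : ((y₁ ^ 2 - x₀ ^ 2) + L) ^ 2 ≤ (2 * m) ^ 2 := by
    have h := mul_nonneg (show 0 ≤ 2 * m - ((y₁ ^ 2 - x₀ ^ 2) + L) by linarith) (show 0 ≤ 2 * m + ((y₁ ^ 2 - x₀ ^ 2) + L) by linarith)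
    nlinarith [h]
  have hCS : L ^ 2 ≤ (e₀ ^ 2 + e₃ ^ 2) * ((x₀ + y₁) ^ 2 + (x₀ - y₁) ^ 2) := by
    have : (e₀ ^ 2 + e₃ ^ 2) * ((x₀ + y₁) ^ 2 + (x₀ - y₁) ^ 2) - L ^ 2 = (e₀ * (x₀ - y₁) + e₃ * (x₀ + y₁)) ^ 2 := by
      rw [hL]; ring
    linarith [sq_nonneg (e₀ * (x₀ - y₁) + e₃ * (x₀ + y₁))]
  have hr2 : (x₀ + y₁) ^ 2 + (x₀ - y₁) ^ 2 = 2 * (x₀ ^ 2 + y₁ ^ 2) := by ring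
  have hL2 : L ^ 2 ≤ 8 * m * (x₀ ^ 2 + y₁ ^ 2) := by
    rw [hr2] at hCS
    have h' : (e₀ ^ 2 + e₃ ^ 2) * (2 * (x₀ ^ 2 + y₁ ^ 2)) ≤ 4 * m * (2 * (x₀ ^ 2 + y₁ ^ 2)) :=
      mul_le_mul_of_nonneg_right hE (by positivity)
    linarith
  have hu4 : (y₁ ^ 2 - x₀ ^ 2) ^ 2 ≤ 8 * m ^ 2 + 2 * L ^ 2 := by
    have : 2 * ((y₁ ^ 2 - x₀ ^ 2) + L) ^ 2 + 2 * L ^ 2 - (y₁ ^ 2 - x₀ ^ 2) ^ 2 = ((y₁ ^ 2 - x₀ ^ 2) + 2 * L) ^ 2 := by ring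
    linarith [sq_nonneg ((y₁ ^ 2 - x₀ ^ 2) + 2 * L)]
  have hr4 : (x₀ ^ 2 + y₁ ^ 2) ^ 2 = (y₁ ^ 2 - x₀ ^ 2) ^ 2 + (2 * (x₀ * y₁)) ^ 2 := by ring
  have key : (x₀ ^ 2 + y₁ ^ 2) ^ 2 ≤ 12 * m ^ 2 + 16 * m * (x₀ ^ 2 + y₁ ^ 2) := by linarith
  refine ⟨?_, by ring_nf; ring_nf at hE; linarith⟩
  by_contra hlt
  push Not at hlt
  have h1' : 17 * m * (x₀ ^ 2 + y₁ ^ 2) < (x₀ ^ 2 + y₁ ^ 2) * (x₀ ^ 2 + y₁ ^ 2) :=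
    mul_lt_mul_of_pos_right hlt (lt_of_le_of_lt (by positivity) hlt)
  have h2' : 17 * m * (17 * m) ≤ 17 * m * (x₀ ^ 2 + y₁ ^ 2) := mul_le_mul_of_nonneg_left hlt.le (by positivity)
  nlinarith [h1', h2', key, sq_nonneg m]

/-- Clearing the frame normalisation `√2 · 2^n`. [folklore] -/
theorem div_sqrt_two_mul (a c : ℝ) : a / (Real.sqrt 2 * c) = (a / c) / Real.sqrt 2 := by
  rw [div_div, mul_comm]


/-- **The site inequality in the frame coordinates**: fluxes `Φ_k`, `Ψ_k` given by the formulas of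
`sum_vertexStep_eq_neg_norm_sq`, the four relations, and the increments `Ψ_k - Φ_k ≤ m` give
`Φ_k ≤ 32 m`. [cite: ChelkakSmirnov2012Ising, Prop. 3.6] -/
theorem site_comparability_real {Φ₀ Φ₁ Φ₂ Φ₃ Ψ₀ Ψ₁ Ψ₂ Ψ₃ x₀ y₀ x₁ y₁ x₂ y₂ x₃ y₃ m : ℝ}
    (e0 : Φ₀ = x₀ ^ 2 / (Real.sqrt 2 * 2 ^ 0)) (e1 : Φ₁ = (x₁ - y₁) ^ 2 / (Real.sqrt 2 * 2 ^ 1))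
    (e2 : Φ₂ = (-2 * y₂) ^ 2 / (Real.sqrt 2 * 2 ^ 2)) (e3 : Φ₃ = (-2 * x₃ - 2 * y₃) ^ 2 / (Real.sqrt 2 * 2 ^ 3))
    (f0 : Ψ₀ = (x₀ - y₀) ^ 2 / (Real.sqrt 2 * 2 ^ 1)) (f1 : Ψ₁ = (-2 * y₁) ^ 2 / (Real.sqrt 2 * 2 ^ 2))
    (f2 : Ψ₂ = (-2 * x₂ - 2 * y₂) ^ 2 / (Real.sqrt 2 * 2 ^ 3)) (f3 : Ψ₃ = x₃ ^ 2 / (Real.sqrt 2 * 2 ^ 0))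
    (c0 : x₀ = x₁) (c1 : x₁ - y₁ = x₂ - y₂) (c2 : -2 * y₂ = -2 * y₃)
    (c3 : -2 * x₃ - 2 * y₃ = -2 * x₀ - 2 * y₀)
    (h0 : Ψ₀ - Φ₀ ≤ m) (h1 : Ψ₁ - Φ₁ ≤ m) (h2 : Ψ₂ - Φ₂ ≤ m) (h3 : Ψ₃ - Φ₃ ≤ m) :
    Φ₀ ≤ 32 * m ∧ Φ₁ ≤ 32 * m ∧ Φ₂ ≤ 32 * m ∧ Φ₃ ≤ 32 * m := by
  have hs0 : (0 : ℝ) < Real.sqrt 2 := Real.sqrt_pos.2 two_pos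
  have hx₁ : x₁ = x₀ := c0.symm
  have hy₃ : y₃ = y₂ := by linarith
  have hx₂ : x₂ = x₀ - y₁ + y₂ := by linarith
  have hx₃ : x₃ = x₀ + y₀ - y₂ := by linarith
  rw [hx₁] at e1
  rw [hx₂] at f2
  rw [hx₃, hy₃] at e3
  rw [hx₃] at f3
  -- the four increments, scaled by `√2`
  have d0 : (x₀ - y₀) ^ 2 / 2 - x₀ ^ 2 ≤ Real.sqrt 2 * m := by
    have e : Ψ₀ - Φ₀ = ((x₀ - y₀) ^ 2 / 2 - x₀ ^ 2) / Real.sqrt 2 := by rw [f0, e0]; field_simp; try ring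
    rw [e, div_le_iff₀ hs0] at h0; linarith
  have d1 : y₁ ^ 2 - (x₀ - y₁) ^ 2 / 2 ≤ Real.sqrt 2 * m := by
    have e : Ψ₁ - Φ₁ = (y₁ ^ 2 - (x₀ - y₁) ^ 2 / 2) / Real.sqrt 2 := by rw [f1, e1]; field_simp; try ring
    rw [e, div_le_iff₀ hs0] at h1; linarith
  have d2 : (x₀ - y₁ + 2 * y₂) ^ 2 / 2 - y₂ ^ 2 ≤ Real.sqrt 2 * m := by
    have e : Ψ₂ - Φ₂ = ((x₀ - y₁ + 2 * y₂) ^ 2 / 2 - y₂ ^ 2) / Real.sqrt 2 := by rw [f2, e2]; field_simp; try ring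
    rw [e, div_le_iff₀ hs0] at h2; linarith
  have d3 : (x₀ + y₀ - y₂) ^ 2 - (x₀ + y₀) ^ 2 / 2 ≤ Real.sqrt 2 * m := by
    have e : Ψ₃ - Φ₃ = ((x₀ + y₀ - y₂) ^ 2 - (x₀ + y₀) ^ 2 / 2) / Real.sqrt 2 := by rw [f3, e3]; field_simp; try ring
    rw [e, div_le_iff₀ hs0] at h3; linarith
  obtain ⟨hr, hE⟩ := site_comparability_alg x₀ y₀ y₁ y₂ (Real.sqrt 2 * m) d0 d1 d2 d3
  have hm0 : 0 ≤ Real.sqrt 2 * m := by linarith [sq_nonneg (y₀ - y₂), sq_nonneg (y₁ - y₂)]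
  have t1 : (x₀ + -y₂ + -(y₁ - y₂)) ^ 2 ≤ 3 * (x₀ ^ 2 + (-y₂) ^ 2 + (-(y₁ - y₂)) ^ 2) := by
    have i : 3 * (x₀ ^ 2 + (-y₂) ^ 2 + (-(y₁ - y₂)) ^ 2) - (x₀ + -y₂ + -(y₁ - y₂)) ^ 2 =
        (x₀ + y₂) ^ 2 + (x₀ + (y₁ - y₂)) ^ 2 + (y₂ - (y₁ - y₂)) ^ 2 := by ring
    linarith [sq_nonneg (x₀ + y₂), sq_nonneg (x₀ + (y₁ - y₂)), sq_nonneg (y₂ - (y₁ - y₂))]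
  have t3 : (x₀ + y₂ + (y₀ - y₂)) ^ 2 ≤ 3 * (x₀ ^ 2 + y₂ ^ 2 + (y₀ - y₂) ^ 2) := by
    have i : 3 * (x₀ ^ 2 + y₂ ^ 2 + (y₀ - y₂) ^ 2) - (x₀ + y₂ + (y₀ - y₂)) ^ 2 =
        (x₀ - y₂) ^ 2 + (x₀ - (y₀ - y₂)) ^ 2 + (y₂ - (y₀ - y₂)) ^ 2 := by ring
    linarith [sq_nonneg (x₀ - y₂), sq_nonneg (x₀ - (y₀ - y₂)), sq_nonneg (y₂ - (y₀ - y₂))]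
  have hy0 := sq_nonneg (y₀ - y₂)
  have hy1 := sq_nonneg (y₁ - y₂)
  refine ⟨?_, ?_, ?_, ?_⟩
  · rw [e0, div_le_iff₀ (by positivity)]
    linarith [sq_nonneg y₂]
  · rw [e1, div_le_iff₀ (by positivity)]
    have e : (x₀ - y₁) ^ 2 = (x₀ + -y₂ + -(y₁ - y₂)) ^ 2 := by ring
    rw [e]
    linarith
  · rw [e2, div_le_iff₀ (by positivity)]
    linarith [sq_nonneg x₀]
  · rw [e3, div_le_iff₀ (by positivity)]
    have e : (-2 * (x₀ + y₀ - y₂) - 2 * y₂) ^ 2 = 4 * (x₀ + y₂ + (y₀ - y₂)) ^ 2 := by ring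
    rw [e]
    linarith

/-- **The plaquette inequality in the frame coordinates** (formulas of `sum_faceStep_eq_norm_sq`). [cite: ChelkakSmirnov2012Ising, Prop. 3.6] -/
theorem face_comparability_real {Φ₀ Φ₁ Φ₂ Φ₃ Ψ₀ Ψ₁ Ψ₂ Ψ₃ x₀ y₀ x₁ y₁ x₂ y₂ x₃ y₃ m : ℝ}
    (e0 : Φ₀ = x₀ ^ 2 / (Real.sqrt 2 * 2 ^ 0)) (e1 : Φ₁ = (x₁ - y₁) ^ 2 / (Real.sqrt 2 * 2 ^ 1))
    (e2 : Φ₂ = (-2 * y₂) ^ 2 / (Real.sqrt 2 * 2 ^ 2)) (e3 : Φ₃ = (-2 * x₃ - 2 * y₃) ^ 2 / (Real.sqrt 2 * 2 ^ 3))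
    (f0 : Ψ₀ = (-2 * x₀ - 2 * y₀) ^ 2 / (Real.sqrt 2 * 2 ^ 3)) (f1 : Ψ₁ = x₁ ^ 2 / (Real.sqrt 2 * 2 ^ 0))
    (f2 : Ψ₂ = (x₂ - y₂) ^ 2 / (Real.sqrt 2 * 2 ^ 1)) (f3 : Ψ₃ = (-2 * y₃) ^ 2 / (Real.sqrt 2 * 2 ^ 2))
    (c0 : x₀ = x₃) (c1 : x₁ - y₁ = x₀ - y₀) (c2 : -2 * y₂ = -2 * y₁)
    (c3 : -2 * x₃ - 2 * y₃ = -2 * x₂ - 2 * y₂)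
    (h0 : Ψ₀ - Φ₀ ≤ m) (h1 : Ψ₁ - Φ₁ ≤ m) (h2 : Ψ₂ - Φ₂ ≤ m) (h3 : Ψ₃ - Φ₃ ≤ m) :
    Φ₀ ≤ 32 * m ∧ Φ₁ ≤ 32 * m ∧ Φ₂ ≤ 32 * m ∧ Φ₃ ≤ 32 * m := by
  have hs0 : (0 : ℝ) < Real.sqrt 2 := Real.sqrt_pos.2 two_pos
  have hy₂ : y₂ = y₁ := by linarith
  have hx₁ : x₁ = x₀ - y₀ + y₁ := by linarith
  have hx₃ : x₃ = x₀ := c0.symm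
  have hx₂ : x₂ = x₀ + y₃ - y₁ := by linarith
  rw [hx₁] at e1 f1
  rw [hy₂] at e2
  rw [hx₂, hy₂] at f2
  rw [hx₃] at e3
  have d0 : (x₀ + y₀) ^ 2 / 2 - x₀ ^ 2 ≤ Real.sqrt 2 * m := by
    have e : Ψ₀ - Φ₀ = ((x₀ + y₀) ^ 2 / 2 - x₀ ^ 2) / Real.sqrt 2 := by rw [f0, e0]; field_simp; try ring
    rw [e, div_le_iff₀ hs0] at h0; linarith
  have d1 : (x₀ - y₀ + y₁) ^ 2 - (x₀ - y₀) ^ 2 / 2 ≤ Real.sqrt 2 * m := by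
    have e : Ψ₁ - Φ₁ = ((x₀ - y₀ + y₁) ^ 2 - (x₀ - y₀) ^ 2 / 2) / Real.sqrt 2 := by rw [f1, e1]; field_simp; try ring
    rw [e, div_le_iff₀ hs0] at h1; linarith
  have d2 : (x₀ + y₃ - 2 * y₁) ^ 2 / 2 - y₁ ^ 2 ≤ Real.sqrt 2 * m := by
    have e : Ψ₂ - Φ₂ = ((x₀ + y₃ - 2 * y₁) ^ 2 / 2 - y₁ ^ 2) / Real.sqrt 2 := by rw [f2, e2]; field_simp; try ring
    rw [e, div_le_iff₀ hs0] at h2; linarith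
  have d3 : y₃ ^ 2 - (x₀ + y₃) ^ 2 / 2 ≤ Real.sqrt 2 * m := by
    have e : Ψ₃ - Φ₃ = (y₃ ^ 2 - (x₀ + y₃) ^ 2 / 2) / Real.sqrt 2 := by rw [f3, e3]; field_simp; try ring
    rw [e, div_le_iff₀ hs0] at h3; linarith
  obtain ⟨hr, hE⟩ := face_comparability_alg x₀ y₀ y₁ y₃ (Real.sqrt 2 * m) d0 d1 d2 d3
  have hm0 : 0 ≤ Real.sqrt 2 * m := by linarith [sq_nonneg (y₀ - y₁), sq_nonneg (y₃ - y₁)]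
  have t1 : (x₀ + -y₁ + -(y₀ - y₁)) ^ 2 ≤ 3 * (x₀ ^ 2 + (-y₁) ^ 2 + (-(y₀ - y₁)) ^ 2) := by
    have i : 3 * (x₀ ^ 2 + (-y₁) ^ 2 + (-(y₀ - y₁)) ^ 2) - (x₀ + -y₁ + -(y₀ - y₁)) ^ 2 =
        (x₀ + y₁) ^ 2 + (x₀ + (y₀ - y₁)) ^ 2 + (y₁ - (y₀ - y₁)) ^ 2 := by ring
    linarith [sq_nonneg (x₀ + y₁), sq_nonneg (x₀ + (y₀ - y₁)), sq_nonneg (y₁ - (y₀ - y₁))]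
  have t3 : (x₀ + y₁ + (y₃ - y₁)) ^ 2 ≤ 3 * (x₀ ^ 2 + y₁ ^ 2 + (y₃ - y₁) ^ 2) := by
    have i : 3 * (x₀ ^ 2 + y₁ ^ 2 + (y₃ - y₁) ^ 2) - (x₀ + y₁ + (y₃ - y₁)) ^ 2 =
        (x₀ - y₁) ^ 2 + (x₀ - (y₃ - y₁)) ^ 2 + (y₁ - (y₃ - y₁)) ^ 2 := by ring
    linarith [sq_nonneg (x₀ - y₁), sq_nonneg (x₀ - (y₃ - y₁)), sq_nonneg (y₁ - (y₃ - y₁))]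
  have hy0 := sq_nonneg (y₀ - y₁)
  have hy3 := sq_nonneg (y₃ - y₁)
  refine ⟨?_, ?_, ?_, ?_⟩
  · rw [e0, div_le_iff₀ (by positivity)]
    linarith [sq_nonneg y₁]
  · rw [e1, div_le_iff₀ (by positivity)]
    have e : (x₀ - y₀ + y₁ - y₁) ^ 2 = (x₀ + -y₁ + -(y₀ - y₁)) ^ 2 := by ring
    rw [e]
    linarith
  · rw [e2, div_le_iff₀ (by positivity)]
    linarith [sq_nonneg x₀]
  · rw [e3, div_le_iff₀ (by positivity)]
    have e : (-2 * x₀ - 2 * y₃) ^ 2 = 4 * (x₀ + y₁ + (y₃ - y₁)) ^ 2 := by ring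
    rw [e]
    linarith

/-! ### Comparability around a site -/

/-- **Uniform comparability at a site** (CS12 Prop. 3.6 on `ℤ²`, the vertex `w` on the superharmonic
sublattice): if `F` is s-holomorphic at the eight corners around `u` and the four increments
`Φ(u + e_k, k + 1) - Φ(u, k)` are at most `m`, then the four inner fluxes are at most `32 m`. For a
primitive pair: `Hw(u + e_k) ≥ Hw(u) - m` for all `k` implies `Hb(faceAt u k) ≤ Hw(u) + 32 m`. [cite: ChelkakSmirnov2012Ising, Prop. 3.6 and Remark 3.10] -/
theorem site_comparability (F : MedialVertex → ℂ) (u : Site 2)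
    (h : ∀ k : Fin 4, IsSHolAt F (u, k)) (h' : ∀ k : Fin 4, IsSHolAt F (u + cornerUnit k, k + 1)) {m : ℝ}
    (hm : ∀ k : Fin 4, cornerFlux F (u + cornerUnit k, k + 1) - cornerFlux F (u, k) ≤ m) :
    ∀ k : Fin 4, cornerFlux F (u, k) ≤ 32 * m := by
  obtain ⟨r0, r1, -, r3⟩ := re_mul_one_add_I_pow (frameCoord u (F (cSrc (u, 0))))
  obtain ⟨s0, s1, s2, -⟩ := re_mul_one_add_I_pow (frameCoord u (F (cSrc (u, 1))))
  obtain ⟨-, t1, t2, t3⟩ := re_mul_one_add_I_pow (frameCoord u (F (cSrc (u, 2))))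
  obtain ⟨w0, -, w2, w3⟩ := re_mul_one_add_I_pow (frameCoord u (F (cSrc (u, 3))))
  -- inner fluxes
  have e0 : cornerFlux F (u, 0) = (frameCoord u (F (cSrc (u, 0)))).re ^ 2 / (Real.sqrt 2 * 2 ^ 0) := by
    show ‖projLine (cornerLine u (faceAt u 0)) (F (cSrc (u, 0)))‖ ^ 2 = _
    rw [norm_projLine_cornerLine_sq u u 0 (n := 0) rfl, r0]
  have e1 : cornerFlux F (u, 1) = ((frameCoord u (F (cSrc (u, 1)))).re -
      (frameCoord u (F (cSrc (u, 1)))).im) ^ 2 / (Real.sqrt 2 * 2 ^ 1) := by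
    show ‖projLine (cornerLine u (faceAt u 1)) (F (cSrc (u, 1)))‖ ^ 2 = _
    rw [norm_projLine_cornerLine_sq u u 1 (n := 1) rfl, s1]
  have e2 : cornerFlux F (u, 2) = (-2 * (frameCoord u (F (cSrc (u, 2)))).im) ^ 2 /
      (Real.sqrt 2 * 2 ^ 2) := by
    show ‖projLine (cornerLine u (faceAt u 2)) (F (cSrc (u, 2)))‖ ^ 2 = _
    rw [norm_projLine_cornerLine_sq u u 2 (n := 2) rfl, t2]
  have e3 : cornerFlux F (u, 3) = (-2 * (frameCoord u (F (cSrc (u, 3)))).re -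
      2 * (frameCoord u (F (cSrc (u, 3)))).im) ^ 2 / (Real.sqrt 2 * 2 ^ 3) := by
    show ‖projLine (cornerLine u (faceAt u 3)) (F (cSrc (u, 3)))‖ ^ 2 = _
    rw [norm_projLine_cornerLine_sq u u 3 (n := 3) rfl, w3]
  -- outer fluxes, read at `e_k` through `h'`
  have f0 : cornerFlux F (u + cornerUnit 0, 0 + 1) = ((frameCoord u (F (cSrc (u, 0)))).re -
      (frameCoord u (F (cSrc (u, 0)))).im) ^ 2 / (Real.sqrt 2 * 2 ^ 1) := by
    rw [(h' 0).cornerFlux_eq, cTgt_add_cornerUnit_succ]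
    show ‖projLine (cornerLine (u + cornerUnit 0) (faceAt (u + cornerUnit 0) (0 + 1)))
      (F (cSrc (u, 0)))‖ ^ 2 = _
    rw [norm_projLine_cornerLine_sq u _ (0 + 1) (n := 1) rfl, r1]
  have f1 : cornerFlux F (u + cornerUnit 1, 1 + 1) = (-2 * (frameCoord u (F (cSrc (u, 1)))).im) ^ 2 /
      (Real.sqrt 2 * 2 ^ 2) := by
    rw [(h' 1).cornerFlux_eq, cTgt_add_cornerUnit_succ]
    show ‖projLine (cornerLine (u + cornerUnit 1) (faceAt (u + cornerUnit 1) (1 + 1)))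
      (F (cSrc (u, 1)))‖ ^ 2 = _
    rw [norm_projLine_cornerLine_sq u _ (1 + 1) (n := 2) rfl, s2]
  have f2 : cornerFlux F (u + cornerUnit 2, 2 + 1) = (-2 * (frameCoord u (F (cSrc (u, 2)))).re -
      2 * (frameCoord u (F (cSrc (u, 2)))).im) ^ 2 / (Real.sqrt 2 * 2 ^ 3) := by
    rw [(h' 2).cornerFlux_eq, cTgt_add_cornerUnit_succ]
    show ‖projLine (cornerLine (u + cornerUnit 2) (faceAt (u + cornerUnit 2) (2 + 1)))
      (F (cSrc (u, 2)))‖ ^ 2 = _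
    rw [norm_projLine_cornerLine_sq u _ (2 + 1) (n := 3) rfl, t3]
  have f3 : cornerFlux F (u + cornerUnit 3, 3 + 1) = (frameCoord u (F (cSrc (u, 3)))).re ^ 2 /
      (Real.sqrt 2 * 2 ^ 0) := by
    rw [(h' 3).cornerFlux_eq, cTgt_add_cornerUnit_succ]
    show ‖projLine (cornerLine (u + cornerUnit 3) (faceAt (u + cornerUnit 3) (3 + 1)))
      (F (cSrc (u, 3)))‖ ^ 2 = _
    rw [norm_projLine_cornerLine_sq u _ (3 + 1) (n := 0) rfl, w0]
  -- the four relations around `u`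
  have c0 : (frameCoord u (F (cSrc (u, 0)))).re = (frameCoord u (F (cSrc (u, 1)))).re := by
    have hc := (projLine_cornerLine_eq_iff u u 0 (n := 0) rfl _ _).1 (h 0)
    rwa [show cTgt (u, 0) = cSrc (u, 1) from rfl, r0, s0] at hc
  have c1 : (frameCoord u (F (cSrc (u, 1)))).re - (frameCoord u (F (cSrc (u, 1)))).im =
      (frameCoord u (F (cSrc (u, 2)))).re - (frameCoord u (F (cSrc (u, 2)))).im := by
    have hc := (projLine_cornerLine_eq_iff u u 1 (n := 1) rfl _ _).1 (h 1)
    rwa [show cTgt (u, 1) = cSrc (u, 2) from rfl, s1, t1] at hc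
  have c2 : -2 * (frameCoord u (F (cSrc (u, 2)))).im = -2 * (frameCoord u (F (cSrc (u, 3)))).im := by
    have hc := (projLine_cornerLine_eq_iff u u 2 (n := 2) rfl _ _).1 (h 2)
    rwa [show cTgt (u, 2) = cSrc (u, 3) from rfl, t2, w2] at hc
  have c3 : -2 * (frameCoord u (F (cSrc (u, 3)))).re - 2 * (frameCoord u (F (cSrc (u, 3)))).im =
      -2 * (frameCoord u (F (cSrc (u, 0)))).re - 2 * (frameCoord u (F (cSrc (u, 0)))).im := by
    have hc := (projLine_cornerLine_eq_iff u u 3 (n := 3) rfl _ _).1 (h 3)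
    rwa [show cTgt (u, 3) = cSrc (u, 0) from rfl, w3, r3] at hc
  have key := site_comparability_real e0 e1 e2 e3 f0 f1 f2 f3 c0 c1 c2 c3 (hm 0) (hm 1) (hm 2) (hm 3)
  intro k
  fin_cases k
  · exact key.1
  · exact key.2.1
  · exact key.2.2.1
  · exact key.2.2.2

/-! ### Comparability around a plaquette -/

/-- **Uniform comparability at a plaquette** (CS12 Prop. 3.6 on `ℤ²`, the vertex `w` a face): if `F`
is s-holomorphic at the eight corners around the plaquette `f` and the four increments
`Φ(v_j, j + 3) - Φ(v_j, j)` are at most `m`, then the four inner fluxes are at most `32 m`. [cite: ChelkakSmirnov2012Ising, Prop. 3.6 and Remark 3.10] -/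
theorem face_comparability (F : MedialVertex → ℂ) (f : Site 2)
    (h : ∀ j : Fin 4, IsSHolAt F (f + cornerOff j, j)) (h' : ∀ j : Fin 4, IsSHolAt F (f + cornerOff j, j + 3)) {m : ℝ}
    (hm : ∀ j : Fin 4, cornerFlux F (f + cornerOff j, j + 3) - cornerFlux F (f + cornerOff j, j) ≤ m) :
    ∀ j : Fin 4, cornerFlux F (f + cornerOff j, j) ≤ 32 * m := by
  obtain ⟨r0, r1, -, r3⟩ := re_mul_one_add_I_pow (frameCoord f (F (cSrc (f + cornerOff 0, 0))))
  obtain ⟨s0, s1, s2, -⟩ := re_mul_one_add_I_pow (frameCoord f (F (cSrc (f + cornerOff 1, 1))))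
  obtain ⟨-, t1, t2, t3⟩ := re_mul_one_add_I_pow (frameCoord f (F (cSrc (f + cornerOff 2, 2))))
  obtain ⟨w0, -, w2, w3⟩ := re_mul_one_add_I_pow (frameCoord f (F (cSrc (f + cornerOff 3, 3))))
  -- inner fluxes (corners of the face, lines `j`)
  have e0 : cornerFlux F (f + cornerOff 0, 0) =
      (frameCoord f (F (cSrc (f + cornerOff 0, 0)))).re ^ 2 / (Real.sqrt 2 * 2 ^ 0) := by
    show ‖projLine (cornerLine (f + cornerOff 0) (faceAt (f + cornerOff 0) 0))
      (F (cSrc (f + cornerOff 0, 0)))‖ ^ 2 = _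
    rw [norm_projLine_cornerLine_sq f _ 0 (n := 0) rfl, r0]
  have e1 : cornerFlux F (f + cornerOff 1, 1) = ((frameCoord f (F (cSrc (f + cornerOff 1, 1)))).re -
      (frameCoord f (F (cSrc (f + cornerOff 1, 1)))).im) ^ 2 / (Real.sqrt 2 * 2 ^ 1) := by
    show ‖projLine (cornerLine (f + cornerOff 1) (faceAt (f + cornerOff 1) 1))
      (F (cSrc (f + cornerOff 1, 1)))‖ ^ 2 = _
    rw [norm_projLine_cornerLine_sq f _ 1 (n := 1) rfl, s1]
  have e2 : cornerFlux F (f + cornerOff 2, 2) = (-2 * (frameCoord f (F (cSrc (f + cornerOff 2, 2)))).im) ^ 2 /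
      (Real.sqrt 2 * 2 ^ 2) := by
    show ‖projLine (cornerLine (f + cornerOff 2) (faceAt (f + cornerOff 2) 2))
      (F (cSrc (f + cornerOff 2, 2)))‖ ^ 2 = _
    rw [norm_projLine_cornerLine_sq f _ 2 (n := 2) rfl, t2]
  have e3 : cornerFlux F (f + cornerOff 3, 3) = (-2 * (frameCoord f (F (cSrc (f + cornerOff 3, 3)))).re -
      2 * (frameCoord f (F (cSrc (f + cornerOff 3, 3)))).im) ^ 2 / (Real.sqrt 2 * 2 ^ 3) := by
    show ‖projLine (cornerLine (f + cornerOff 3) (faceAt (f + cornerOff 3) 3))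
      (F (cSrc (f + cornerOff 3, 3)))‖ ^ 2 = _
    rw [norm_projLine_cornerLine_sq f _ 3 (n := 3) rfl, w3]
  -- outer fluxes (corners `(f + cornerOff j, j + 3)`, lines `j + 3`), read at `E_j` through `h'`
  have f0 : cornerFlux F (f + cornerOff 0, 0 + 3) = (-2 * (frameCoord f (F (cSrc (f + cornerOff 0, 0)))).re -
      2 * (frameCoord f (F (cSrc (f + cornerOff 0, 0)))).im) ^ 2 / (Real.sqrt 2 * 2 ^ 3) := by
    rw [(h' 0).cornerFlux_eq, cTgt_add_three]
    show ‖projLine (cornerLine (f + cornerOff 0) (faceAt (f + cornerOff 0) (0 + 3)))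
      (F (cSrc (f + cornerOff 0, 0)))‖ ^ 2 = _
    rw [norm_projLine_cornerLine_sq f _ (0 + 3) (n := 3) rfl, r3]
  have f1 : cornerFlux F (f + cornerOff 1, 1 + 3) =
      (frameCoord f (F (cSrc (f + cornerOff 1, 1)))).re ^ 2 / (Real.sqrt 2 * 2 ^ 0) := by
    rw [(h' 1).cornerFlux_eq, cTgt_add_three]
    show ‖projLine (cornerLine (f + cornerOff 1) (faceAt (f + cornerOff 1) (1 + 3)))
      (F (cSrc (f + cornerOff 1, 1)))‖ ^ 2 = _
    rw [norm_projLine_cornerLine_sq f _ (1 + 3) (n := 0) rfl, s0]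
  have f2 : cornerFlux F (f + cornerOff 2, 2 + 3) = ((frameCoord f (F (cSrc (f + cornerOff 2, 2)))).re -
      (frameCoord f (F (cSrc (f + cornerOff 2, 2)))).im) ^ 2 / (Real.sqrt 2 * 2 ^ 1) := by
    rw [(h' 2).cornerFlux_eq, cTgt_add_three]
    show ‖projLine (cornerLine (f + cornerOff 2) (faceAt (f + cornerOff 2) (2 + 3)))
      (F (cSrc (f + cornerOff 2, 2)))‖ ^ 2 = _
    rw [norm_projLine_cornerLine_sq f _ (2 + 3) (n := 1) rfl, t1]
  have f3 : cornerFlux F (f + cornerOff 3, 3 + 3) = (-2 * (frameCoord f (F (cSrc (f + cornerOff 3, 3)))).im) ^ 2 /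
      (Real.sqrt 2 * 2 ^ 2) := by
    rw [(h' 3).cornerFlux_eq, cTgt_add_three]
    show ‖projLine (cornerLine (f + cornerOff 3) (faceAt (f + cornerOff 3) (3 + 3)))
      (F (cSrc (f + cornerOff 3, 3)))‖ ^ 2 = _
    rw [norm_projLine_cornerLine_sq f _ (3 + 3) (n := 2) rfl, w2]
  -- the four relations at the corners of the face (`E_j` and `E_{j+3}` project equally onto `ℓ_j`)
  have c0 : (frameCoord f (F (cSrc (f + cornerOff 0, 0)))).re =
      (frameCoord f (F (cSrc (f + cornerOff 3, 3)))).re := by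
    have hc := (projLine_cornerLine_eq_iff f (f + cornerOff 0) 0 (n := 0) rfl _ _).1 (h 0)
    rwa [cTgt_face_corner f (j := 0) (i := 3) (by decide), r0, w0] at hc
  have c1 : (frameCoord f (F (cSrc (f + cornerOff 1, 1)))).re - (frameCoord f (F (cSrc (f + cornerOff 1, 1)))).im =
      (frameCoord f (F (cSrc (f + cornerOff 0, 0)))).re - (frameCoord f (F (cSrc (f + cornerOff 0, 0)))).im := by
    have hc := (projLine_cornerLine_eq_iff f (f + cornerOff 1) 1 (n := 1) rfl _ _).1 (h 1)
    rwa [cTgt_face_corner f (j := 1) (i := 0) (by decide), s1, r1] at hc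
  have c2 : -2 * (frameCoord f (F (cSrc (f + cornerOff 2, 2)))).im =
      -2 * (frameCoord f (F (cSrc (f + cornerOff 1, 1)))).im := by
    have hc := (projLine_cornerLine_eq_iff f (f + cornerOff 2) 2 (n := 2) rfl _ _).1 (h 2)
    rwa [cTgt_face_corner f (j := 2) (i := 1) (by decide), t2, s2] at hc
  have c3 : -2 * (frameCoord f (F (cSrc (f + cornerOff 3, 3)))).re - 2 * (frameCoord f (F (cSrc (f + cornerOff 3, 3)))).im =
      -2 * (frameCoord f (F (cSrc (f + cornerOff 2, 2)))).re - 2 * (frameCoord f (F (cSrc (f + cornerOff 2, 2)))).im := by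
    have hc := (projLine_cornerLine_eq_iff f (f + cornerOff 3) 3 (n := 3) rfl _ _).1 (h 3)
    rwa [cTgt_face_corner f (j := 3) (i := 2) (by decide), w3, t3] at hc
  have key := face_comparability_real e0 e1 e2 e3 f0 f1 f2 f3 c0 c1 c2 c3 (hm 0) (hm 1) (hm 2) (hm 3)
  intro j
  fin_cases j
  · exact key.1
  · exact key.2.1
  · exact key.2.2.1
  · exact key.2.2.2

/-! ### Sections with sign data of even parity -/

/-- **Comparability at a site for a section** (even parity of the seam corners around `u`): the local
gauge of `KCSpinorLaplacian.lean` reduces to `site_comparability`. [cite: ChelkakSmirnov2012Ising, Prop. 3.6; ChelkakHonglerIzyurovAnnals2015, Remark 3.9] -/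
theorem site_comparability_of_compat (F : MedialVertex → ℂ) (u : Site 2) {s s' : Fin 4 → ℝ}
    (hin : ∀ k, CompatAt F (u, k) (s k)) (hout : ∀ k, CompatAt F (u + cornerUnit k, k + 1) (s' k))
    (hpar : s 0 * s 1 * s 2 * s 3 = 1) {m : ℝ}
    (hm : ∀ k : Fin 4, cornerFlux F (u + cornerUnit k, k + 1) - cornerFlux F (u, k) ≤ m) :
    ∀ k : Fin 4, cornerFlux F (u, k) ≤ 32 * m := by
  have hs := fun k => (hin k).pm
  have hs' := fun k => (hout k).pm
  obtain ⟨c, hc⟩ : ∃ c : Fin 4 → ℝ, c = ![1, s 0, s 0 * s 1, s 0 * s 1 * s 2] := ⟨_, rfl⟩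
  have c0 : c 0 = 1 := by rw [hc]; rfl
  have c1 : c 1 = s 0 := by rw [hc]; rfl
  have c2 : c 2 = s 0 * s 1 := by rw [hc]; rfl
  have c3 : c 3 = s 0 * s 1 * s 2 := by rw [hc]; rfl
  have hcpm : ∀ k, c k = 1 ∨ c k = -1 := by
    intro k
    fin_cases k
    · exact Or.inl c0
    · rw [show c ⟨1, by norm_num⟩ = s 0 from c1]; exact hs 0
    · rw [show c ⟨2, by norm_num⟩ = s 0 * s 1 from c2]; exact pm_mul (hs 0) (hs 1)
    · rw [show c ⟨3, by norm_num⟩ = s 0 * s 1 * s 2 from c3]; exact pm_mul (pm_mul (hs 0) (hs 1)) (hs 2)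
  obtain ⟨d, hd⟩ : ∃ d : Fin 4 → ℝ, d = fun k => s' k * c k := ⟨_, rfl⟩
  have hdpm : ∀ k, d k = 1 ∨ d k = -1 := fun k => by rw [hd]; exact pm_mul (hs' k) (hcpm k)
  have q0 := pm_sq (hs 0)
  have q1 := pm_sq (hs 1)
  have q3 := pm_sq (hs 3)
  have hprod : ∀ k, c k * c (k + 1) = s k := by
    intro k
    fin_cases k
    · show c 0 * c 1 = s 0
      rw [c0, c1, one_mul]
    · show c 1 * c 2 = s 1
      rw [c1, c2]; linear_combination s 1 * q0
    · show c 2 * c 3 = s 2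
      rw [c2, c3]; linear_combination (s 1 * s 1 * s 2) * q0 + s 2 * q1
    · show c 3 * c 0 = s 3
      rw [c3, c0]; linear_combination (-(s 0 * s 1 * s 2)) * q3 + s 3 * hpar
  have hprod' : ∀ k, d k * c k = s' k := by
    intro k; rw [hd]; simp only; rw [mul_assoc, pm_sq (hcpm k), mul_one]
  obtain ⟨χ, hχ⟩ : ∃ χ : MedialVertex → ℝ, χ = siteGauge u c d := ⟨_, rfl⟩
  have hχpm : ∀ e, χ e = 1 ∨ χ e = -1 := by rw [hχ]; exact siteGauge_cases u hcpm hdpm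
  have hvals := siteGauge_values u c d
  rw [← hχ] at hvals
  have hh : ∀ k, IsSHolAt (fun e => (χ e : ℂ) * F e) (u, k) := by
    intro k
    refine CompatAt.gauge (hχpm _) (hχpm _) ?_
    rw [(hvals k).1, (hvals k).2.1, hprod k]; exact hin k
  have hh' : ∀ k, IsSHolAt (fun e => (χ e : ℂ) * F e) (u + cornerUnit k, k + 1) := by
    intro k
    refine CompatAt.gauge (hχpm _) (hχpm _) ?_
    rw [(hvals k).2.2.1, (hvals k).2.2.2, hprod' k]; exact hout k
  have key := site_comparability (fun e => (χ e : ℂ) * F e) u hh hh' (m := m) (fun k => by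
    rw [cornerFlux_sign_mul (hχpm _), cornerFlux_sign_mul (hχpm _)]; exact hm k)
  intro k
  have := key k
  rwa [cornerFlux_sign_mul (hχpm _)] at this

/-- **Comparability at a plaquette for a section** (even parity of the seam corners of `f`). [cite: ChelkakSmirnov2012Ising, Prop. 3.6; ChelkakHonglerIzyurovAnnals2015, Remark 3.9] -/
theorem face_comparability_of_compat (F : MedialVertex → ℂ) (f : Site 2) {t t' : Fin 4 → ℝ}
    (hin : ∀ j, CompatAt F (f + cornerOff j, j) (t j)) (hout : ∀ j, CompatAt F (f + cornerOff j, j + 3) (t' j))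
    (hpar : t 0 * t 1 * t 2 * t 3 = 1) {m : ℝ}
    (hm : ∀ j : Fin 4, cornerFlux F (f + cornerOff j, j + 3) - cornerFlux F (f + cornerOff j, j) ≤ m) :
    ∀ j : Fin 4, cornerFlux F (f + cornerOff j, j) ≤ 32 * m := by
  have ht := fun j => (hin j).pm
  have ht' := fun j => (hout j).pm
  obtain ⟨c, hc⟩ : ∃ c : Fin 4 → ℝ, c = ![1, t 0 * t 3 * t 2, t 0 * t 3, t 0] := ⟨_, rfl⟩
  have c0 : c 0 = 1 := by rw [hc]; rfl
  have c1 : c 1 = t 0 * t 3 * t 2 := by rw [hc]; rfl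
  have c2 : c 2 = t 0 * t 3 := by rw [hc]; rfl
  have c3 : c 3 = t 0 := by rw [hc]; rfl
  have hcpm : ∀ k, c k = 1 ∨ c k = -1 := by
    intro k
    fin_cases k
    · exact Or.inl c0
    · rw [show c ⟨1, by norm_num⟩ = t 0 * t 3 * t 2 from c1]; exact pm_mul (pm_mul (ht 0) (ht 3)) (ht 2)
    · rw [show c ⟨2, by norm_num⟩ = t 0 * t 3 from c2]; exact pm_mul (ht 0) (ht 3)
    · rw [show c ⟨3, by norm_num⟩ = t 0 from c3]; exact ht 0
  obtain ⟨d, hd⟩ : ∃ d : Fin 4 → ℝ, d = fun j => t' j * c j := ⟨_, rfl⟩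
  have hdpm : ∀ k, d k = 1 ∨ d k = -1 := fun k => by rw [hd]; exact pm_mul (ht' k) (hcpm k)
  have q0 := pm_sq (ht 0)
  have q1 := pm_sq (ht 1)
  have q3 := pm_sq (ht 3)
  have hprod : ∀ j, c j * c (j + 3) = t j := by
    intro j
    fin_cases j
    · show c 0 * c 3 = t 0
      rw [c0, c3, one_mul]
    · show c 1 * c 0 = t 1
      rw [c1, c0]; linear_combination (-(t 0 * t 3 * t 2)) * q1 + t 1 * hpar
    · show c 2 * c 1 = t 2
      rw [c2, c1]; linear_combination (t 2 * t 3 * t 3) * q0 + t 2 * q3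
    · show c 3 * c 2 = t 3
      rw [c3, c2]; linear_combination t 3 * q0
  have hprod' : ∀ j, d j * c j = t' j := by
    intro j; rw [hd]; simp only; rw [mul_assoc, pm_sq (hcpm j), mul_one]
  obtain ⟨χ, hχ⟩ : ∃ χ : MedialVertex → ℝ, χ = faceGauge f c d := ⟨_, rfl⟩
  have hχpm : ∀ e, χ e = 1 ∨ χ e = -1 := by rw [hχ]; exact faceGauge_cases f hcpm hdpm
  have hvals := faceGauge_values f c d
  rw [← hχ] at hvals
  have hh : ∀ j, IsSHolAt (fun e => (χ e : ℂ) * F e) (f + cornerOff j, j) := by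
    intro j
    refine CompatAt.gauge (hχpm _) (hχpm _) ?_
    rw [(hvals j).1, (hvals j).2.1, hprod j]; exact hin j
  have hh' : ∀ j, IsSHolAt (fun e => (χ e : ℂ) * F e) (f + cornerOff j, j + 3) := by
    intro j
    refine CompatAt.gauge (hχpm _) (hχpm _) ?_
    rw [(hvals j).2.2.1, (hvals j).2.2.2, hprod' j]; exact hout j
  have key := face_comparability (fun e => (χ e : ℂ) * F e) f hh hh' (m := m) (fun j => by
    rw [cornerFlux_sign_mul (hχpm _), cornerFlux_sign_mul (hχpm _)]; exact hm j)
  intro j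
  have := key j
  rwa [cornerFlux_sign_mul (hχpm _)] at this

end Literature.Probability.LatticeModels
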